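import Summits.BirchSwinnertonDyer.BirchSwinnertonDyer.Theorems.ManinLocalTwoThreeCDivisionUDCConsumers
import Literature.NumberTheory.EllipticCurves.UniformizationUniqueProofs
import HarnessLib

/-!
# The `X₁(N)` side needs NO new witness: transfer of the `c`-division witness from any `X₀(N)`-datum of the SAME curve, and
# `|c₁| = 1` (Stevens' `c_φ = ±1`) modulo CDT ∧ E-an-242 (cell bsd-f2-manin, route `ManinLocalTwoThree`; lead p1 gen 19, LEAD-MEMO v39 §2)

The `c`-division witness of an g44 (E-an-242 `CDivisionWitnessLaw`; nodes N1–N7 PROVED by p2 g20 / p3 g18 / LEAD, assembly `exists_cDivisionWitness` by p3)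
is a statement about the NEWFORM `f` and the NÉRON LATTICE `Λ_W` only: a holomorphic weight-`k` `F` with `Γ₀(N)`-stabiliser `{γ : {∞,γ∞}_f ∈ Λ_W}`,
exponential growth, algebraic-integer `q`-expansion.  An `X₁(N)`-datum `D₁` and an `X₀(N)`-datum `D` of the SAME globally minimal `W` at the same level
share both: `D.f = D₁.f` (a newform is determined by its `q`-expansion, `IsNewformOf.unique`) and `Λ(D.L) = Λ(D₁.L)` (a lattice is determined by
`g₂, g₃` — the uniqueness half of the Uniformisation Theorem, tree theorem `PeriodPair.uniformization_unique_holds`).  Hence (§1) the witness of `D`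
IS a witness for `D₁`, and (§2) with LEAD's `Γ₁`-Wohlfahrt kernel (`CDivisionUDC.periodLatticeGamma1_le_neron₁_of_cDivisionWitness_of_UDW`):
**`|c₁| = 1` for every OPTIMAL `X₁(N)`-datum of a curve carrying an `X₀(N)`-datum at the same level, modulo CDT ∧ E-an-242** — no `Γ₁` row, no
`Γ₁` port of the nodes.  §3: C2 (`|c₀| = 1`) at the levels `4q² ∣ N` modulo CDT ∧ CES ∧ E-an-242 ∧ (every curve of the class carries an `X₀(N)`-datum —
modularity with `N` = conductor).
HONEST FRAMING: CONDITIONAL on the printed CDT fact and on E-an-242 (whose node contents are all proved; the def-free assembly is p3's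
`…CDivisionAssembly`); Stevens' and Manin's conjectures and BSD are NOT proved by this file.  No definitions, no sorry.
[cite: SilvermanAEC2009, Thm. VI.5.1 (uniqueness)] [cite: Stevens1989, §2] [cite: CalegariDimitrovTang2025, Thm. 1.0.1 and Remarks 58–59] [cite: Wohlfahrt1964, Thm. 2]
-/

set_option autoImplicit false
-- lint-debt: the directory name repeats the summit name (sibling precedent `ManinLocalTwoThreeCDivisionUDCConsumers.lean`)
set_option linter.dupNamespace false

noncomputable section

open scoped MatrixGroups ModularForm Manifold
open CongruenceSubgroup
open WeierstrassCurve Literature.NumberTheory.EllipticCurves Literature.NumberTheory.EllipticCurves.ModularForms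
open Literature.NumberTheory.Automorphic
open Summit.BirchSwinnertonDyer.Rank1Residual.ManinAdditive.UDCKummerLineK

namespace Summit.BirchSwinnertonDyer.BirchSwinnertonDyer.Theorems.ManinLocalTwoThree.CDivisionUDC

variable {W : WeierstrassCurve ℚ} [W.IsElliptic] [W.IsGloballyMinimal] {N : ℕ} [NeZero N]

/-! ## §1 Same curve, same level ⟹ same newform and same Néron lattice ⟹ same witness -/

omit [W.IsElliptic] [W.IsGloballyMinimal] in
/-- An `X₀(N)`-datum and an `X₁(N)`-datum of the same curve have the same newform (`IsNewformOf.unique`). [cite: Knapp1993, Thm. 11.67] -/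
theorem f_eq_gamma1 (D : ModularParametrizationData W N) (D₁ : Gamma1ParametrizationData W N) : D.f = D₁.f :=
  D.isNewformOf.unique D₁.isNewformOf

omit [W.IsElliptic] [W.IsGloballyMinimal] in
/-- An `X₀(N)`-datum and an `X₁(N)`-datum of the same curve have the same Néron lattice (both period pairs have invariants `c₄/12, c₆/216`; uniqueness half
of the Uniformisation Theorem, tree `PeriodPair.uniformization_unique_holds`). [cite: SilvermanAEC2009, Thm. VI.5.1 (uniqueness)] -/
theorem lattice_eq_gamma1 (D : ModularParametrizationData W N) (D₁ : Gamma1ParametrizationData W N) : D.L.lattice = D₁.L.lattice :=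
  PeriodPair.uniformization_unique_holds _ _ (D.isNeronLattice.1.trans D₁.isNeronLattice.1.symm)
    (D.isNeronLattice.2.trans D₁.isNeronLattice.2.symm)

omit [W.IsElliptic] [W.IsGloballyMinimal] in
/-- **Transfer of the `c`-division witness to the `X₁(N)`-datum of the same curve.**  A witness for `(D.f, Λ(D.L))` (an g44's E-an-242 shape) is verbatim
a witness for `(D₁.f, Λ(D₁.L))`. [folklore] -/
theorem cDivisionWitness₁_of_datum (D₁ : Gamma1ParametrizationData W N) (D : ModularParametrizationData W N)
    (hW : ∃ (k : ℤ) (F : UpperHalfPlane → ℂ), MDifferentiable 𝓘(ℂ) 𝓘(ℂ) F ∧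
        (∀ γ : Gamma0 N, cuspSymbol D.f γ ∈ D.L.lattice → F ∣[k] (γ : SL(2, ℤ)) = F) ∧
        (∀ γ : Gamma0 N, F ∣[k] (γ : SL(2, ℤ)) = F → cuspSymbol D.f γ ∈ D.L.lattice) ∧
        (∀ g : SL(2, ℤ), ∃ C A m : ℝ, ∀ τ : UpperHalfPlane, A ≤ τ.im → ‖(F ∣[k] g) τ‖ ≤ C * Real.exp (m * τ.im)) ∧
        (∃ b : ℕ → ℂ, (∀ n, IsIntegral ℤ (b n)) ∧ ∀ τ : UpperHalfPlane,
          HasSum (fun n : ℕ ↦ b n * Complex.exp (2 * Real.pi * Complex.I * (τ : ℂ) * n)) (F τ))) :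
    ∃ (k : ℤ) (F : UpperHalfPlane → ℂ), MDifferentiable 𝓘(ℂ) 𝓘(ℂ) F ∧
        (∀ γ : Gamma0 N, cuspSymbol D₁.f γ ∈ D₁.L.lattice → F ∣[k] (γ : SL(2, ℤ)) = F) ∧
        (∀ γ : Gamma0 N, F ∣[k] (γ : SL(2, ℤ)) = F → cuspSymbol D₁.f γ ∈ D₁.L.lattice) ∧
        (∀ g : SL(2, ℤ), ∃ C A m : ℝ, ∀ τ : UpperHalfPlane, A ≤ τ.im → ‖(F ∣[k] g) τ‖ ≤ C * Real.exp (m * τ.im)) ∧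
        (∃ b : ℕ → ℂ, (∀ n, IsIntegral ℤ (b n)) ∧ ∀ τ : UpperHalfPlane,
          HasSum (fun n : ℕ ↦ b n * Complex.exp (2 * Real.pi * Complex.I * (τ : ℂ) * n)) (F τ)) := by
  have hf := f_eq_gamma1 D D₁
  have hΛ := lattice_eq_gamma1 D D₁
  obtain ⟨k, F, hhol, hinv, hstab, hgr, hq⟩ := hW
  refine ⟨k, F, hhol, fun γ hγ ↦ hinv γ (by rw [hf, hΛ]; exact hγ), fun γ hγ ↦ ?_, hgr, hq⟩
  rw [← hf, ← hΛ]; exact hstab γ hγ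

/-! ## §2 `|c₁| = 1` modulo CDT ∧ E-an-242, for every optimal `X₁(N)`-datum of a curve with an `X₀(N)`-datum -/

/-- **`|c₁| = 1` ⟸ CDT ∧ `CDivisionWitnessLaw` (an g44's E-an-242, the `X₀(N)` row — NO `Γ₁` row needed).**  For a globally minimal `W` carrying an
`X₀(N)`-datum `D` and an OPTIMAL `X₁(N)`-datum `D₁` at the same level: the witness of `D` transfers to `D₁` (§1); Unbounded Denominators and the
`Γ₁`-Wohlfahrt lemma give `Λ₁(f) ⊆ Λ_W = c₁·Λ₁(f)` (`periodLatticeGamma1_le_neron₁_of_cDivisionWitness_of_UDW`), absurd unless `|c₁| = 1`.  Stevens'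
conjecture `c_φ = ±1` [Stevens 1989] for every such datum, CONDITIONALLY on the printed CDT fact and on E-an-242 (node contents proved; assembly p3).
Stevens' conjecture, Manin's conjecture and BSD are not proved by this. [cite: Stevens1989, §2] [cite: CalegariDimitrovTang2025, Thm. 1.0.1 and Remarks 58–59] -/
theorem abs_maninConstant₁_eq_one_of_CDT_of_cDivisionWitnessLaw_of_datum
    (hCDT : Literature.NumberTheory.Automorphic.CalegariDimitrovTang2025_unboundedDenominators_algInt)
    (hCW : ∀ (W : WeierstrassCurve ℚ) [W.IsElliptic] [W.IsGloballyMinimal] {N : ℕ} [NeZero N] (D : ModularParametrizationData W N),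
      ∃ (k : ℤ) (F : UpperHalfPlane → ℂ), MDifferentiable 𝓘(ℂ) 𝓘(ℂ) F ∧
        (∀ γ : Gamma0 N, cuspSymbol D.f γ ∈ D.L.lattice → F ∣[k] (γ : SL(2, ℤ)) = F) ∧
        (∀ γ : Gamma0 N, F ∣[k] (γ : SL(2, ℤ)) = F → cuspSymbol D.f γ ∈ D.L.lattice) ∧
        (∀ g : SL(2, ℤ), ∃ C A m : ℝ, ∀ τ : UpperHalfPlane, A ≤ τ.im → ‖(F ∣[k] g) τ‖ ≤ C * Real.exp (m * τ.im)) ∧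
        (∃ b : ℕ → ℂ, (∀ n, IsIntegral ℤ (b n)) ∧ ∀ τ : UpperHalfPlane,
          HasSum (fun n : ℕ ↦ b n * Complex.exp (2 * Real.pi * Complex.I * (τ : ℂ) * n)) (F τ)))
    (D : ModularParametrizationData W N) (D₁ : Gamma1ParametrizationData W N) (hopt : D₁.IsOptimal) :
    |D₁.maninConstant| = 1 := by
  have hc0 : D₁.maninConstant ≠ 0 := D₁.maninConstant_ne_zero
  obtain ⟨k, F, hhol, hinv, hstab, hgrowth, hq⟩ := cDivisionWitness₁_of_datum D₁ D (hCW W D)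
  have hle := periodLatticeGamma1_le_neron₁_of_cDivisionWitness_of_UDW D₁ (UDWOfCDT.unboundedDenominatorsWeightAlgInt_of_CDT_algInt hCDT k)
    hhol hinv hstab hgrowth hq
  rw [Int.abs_eq_natAbs]
  by_contra hne
  have hm : 2 ≤ D₁.maninConstant.natAbs := by
    have h1 : D₁.maninConstant.natAbs ≠ 1 := fun h ↦ hne (by rw [h]; rfl)
    have h0 : D₁.maninConstant.natAbs ≠ 0 := Int.natAbs_ne_zero.mpr hc0
    omega
  refine DivisionGamma1.not_forall_gamma1_division_of_isOptimal D₁ hopt hm fun γ ↦ ?_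
  have hs : cuspSymbol D₁.f ⟨(γ : SL(2, ℤ)), Gamma1_in_Gamma0 N γ.2⟩ ∈ D₁.L.lattice :=
    hle _ (cuspSymbol_mem_periodLatticeGamma1 D₁.f γ)
  change ∃ ν ∈ D₁.L.lattice, (D₁.c : ℂ) * cuspSymbol D₁.f ⟨(γ : SL(2, ℤ)), Gamma1_in_Gamma0 N γ.2⟩ = ((D₁.c.natAbs : ℕ) : ℂ) * ν
  rcases intCast_eq_natAbs_or D₁.c with hc | hc
  · exact ⟨_, hs, by rw [hc]⟩
  · exact ⟨_, neg_mem hs, by rw [hc]; ring⟩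

/-! ## §3 C2 at the levels `4q² ∣ N`, modulo CDT ∧ CES ∧ E-an-242 ∧ (`X₀(N)`-data for the class) -/

/-- **C2 at `4 ∣ N ∧ q² ∣ N` (`q` an odd prime) ⟸ CDT ∧ CES ∧ E-an-242 ∧ (every curve `ℚ`-isogenous to `W` carries an `X₀(N)`-datum at level `N`).**  The last
input is modularity (BCDT) with `N` = conductor (Carayol) — printed; it is kept as a hypothesis because the crux quantifies over arbitrary data.  CES gives the
optimal `X₁(N)`-datum `D₁` of the class on a globally minimal `W₁`; two traceless primes force `|c₀| = |c₁|` (tree `natAbs_maninConstant₀_eq_of_sq_dvd_level_of_ne`);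
§2 gives `|c₁| = 1`.  CONDITIONAL; C2 (one additive prime) is not proved by this.
[cite: CalegariDimitrovTang2025, Thm. 1.0.1] [cite: LingOesterle1991, Thm. 6] [cite: ConradEdixhovenStein2003, §6.1, Lemma 6.1.6] [cite: Stevens1989, §2] -/
theorem abs_maninConstant_eq_one_of_CDT_CES_of_cDivisionWitnessLaw_of_data_of_sq_dvd
    (hCDT : Literature.NumberTheory.Automorphic.CalegariDimitrovTang2025_unboundedDenominators_algInt)
    (hCES : exists_optimal_gamma1ParametrizationData)
    (hCW : ∀ (W : WeierstrassCurve ℚ) [W.IsElliptic] [W.IsGloballyMinimal] {N : ℕ} [NeZero N] (D : ModularParametrizationData W N),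
      ∃ (k : ℤ) (F : UpperHalfPlane → ℂ), MDifferentiable 𝓘(ℂ) 𝓘(ℂ) F ∧
        (∀ γ : Gamma0 N, cuspSymbol D.f γ ∈ D.L.lattice → F ∣[k] (γ : SL(2, ℤ)) = F) ∧
        (∀ γ : Gamma0 N, F ∣[k] (γ : SL(2, ℤ)) = F → cuspSymbol D.f γ ∈ D.L.lattice) ∧
        (∀ g : SL(2, ℤ), ∃ C A m : ℝ, ∀ τ : UpperHalfPlane, A ≤ τ.im → ‖(F ∣[k] g) τ‖ ≤ C * Real.exp (m * τ.im)) ∧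
        (∃ b : ℕ → ℂ, (∀ n, IsIntegral ℤ (b n)) ∧ ∀ τ : UpperHalfPlane,
          HasSum (fun n : ℕ ↦ b n * Complex.exp (2 * Real.pi * Complex.I * (τ : ℂ) * n)) (F τ)))
    (hD : ∀ (W' : WeierstrassCurve ℚ) [W'.IsElliptic] [W'.IsGloballyMinimal], IsIsogenous W' W → Nonempty (ModularParametrizationData W' N))
    (D : ModularParametrizationData W N) (h4 : 2 ^ 2 ∣ N) (hopt : ∀ z ∈ D.L.lattice, ∃ w ∈ periodLattice D.f, z = D.c * w)
    {q : ℕ} (hq : q.Prime) (hq2 : q ≠ 2) (hqN : q ^ 2 ∣ N) :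
    |D.maninConstant| = 1 := by
  obtain ⟨W₁, _, _, D₁, hiso, h₁⟩ := hCES W D hopt
  obtain ⟨D'⟩ := hD W₁ hiso
  have heq := natAbs_maninConstant₀_eq_of_sq_dvd_level_of_ne D₁ D hiso h₁ hopt Nat.prime_two hq (Ne.symm hq2) h4 hqN
  have h1 := abs_maninConstant₁_eq_one_of_CDT_of_cDivisionWitnessLaw_of_datum hCDT hCW D' D₁ h₁
  rw [Int.abs_eq_natAbs] at h1 ⊢
  rw [heq]; exact h1

end Summit.BirchSwinnertonDyer.BirchSwinnertonDyer.Theorems.ManinLocalTwoThree.CDivisionUDC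

end
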